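/-
Copyright: the b2b-balaban T⁴-continuum CRUX team, row NE7b leaf lineage `t4-ne7b-formalise-leaf-02` (gen 134). Project licence.
-/
import Summits.QuantumFields.BalabanUV.T4Continuum.Spine.NE7b.AdmissibleFloorSeminormTerms
import Summits.QuantumFields.BalabanUV.T4Continuum.Spine.NE7b.SineTentQuadraticPartition

/-!
# THE SEMINORM-IMS FLOOR AT k = 1 WITH THE SINE-TENT QUADRATIC PARTITION: `…AdmissibleFloorSeminormTerms.ims_floor_of_linear_terms` with `hpart` ∕ `hlip` ∕ `hμ`
# DISCHARGED on the torus by `…SineTentQuadraticPartition` — `λ = D·π∕(2L)`, `μ = (a+1)·2^d` in general and `λ = π∕(2L)`, `μ = 2^d` in the plaquette shape: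
# `ε = μℓ²λ²ab` WITHOUT the `4·2^d` of a normalisation and WITHOUT the `√2` of an `ℓ²` step (d = 4 plaquette terms: `E·L² = 16·24·π²∕4 ≈ 947`)
# (row NE7b, node U5c; residual (R2′) family (2), letter (ℓ1); one-`exact` junction)

Cell `pub-balaban`, sub-cell `t4`, spine estimate NE7b (`T4WeightBudget.RelWeightBound`; the cell's OWN estimate — NOT PRINTED in [Bałaban 1983–89],
NOT PROVED).  Crux-route work under `Spine/NE7b/`; NOTHING of Bałaban's estimates is asserted; no `def`; zero `sorry`; no `T4Continuum/Support` leaf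
(FREEZE (0)).  Imports BY NAME: leaf-05 g157's `…AdmissibleFloorSeminormTerms` (AFST: `ims_floor_of_linear_terms`) and this lineage's `…SineTentQuadraticPartition`
(STQ: `sum_sq_prod_sin_tent_eq_one`, `abs_prod_sin_tent_sub_le_of_disp` ∕ `_of_unit`, `card_varying_on_term_sin_tent_le` ∕ `_of_unit`).

WHAT IS PROVED ([folklore]; `0 < L`, `2 ≤ M`, `N = M·L`, offset `c₀`; cutoffs `h_S(c) := Π_ν sin(π∕2·tentZ L ((pt c)_ν − (S_ν·L + c₀)))` written out):
* **`ims_floor_of_sine_tent_partition`** — linear local terms `T_j x = Σ_{c∈inc j}R_{j,c}(x c)` (`‖R_{j,c}v‖ ≤ ℓ‖v‖`, `#inc j ≤ a`, `#{j : c ∈ inc j} ≤ b`), bonds read at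
  torus sites `pt` with per-term `ℓ¹`-witnesses of length `≤ D`, local floors `c_loc` for the cutoffs `h_S` on `good`, `Σ_j‖T_j x‖² ≤ F x` on `good`
  ⊢ `((c_loc − (1+t⁻¹)·(a+1)2^d·ℓ²·(Dπ∕(2L))²·ab)∕(1+t))·Σ_c‖x c‖² ≤ F x`.
* **`ims_floor_of_sine_tent_partition_unit`** — the plaquette shape (`hunit`: bonds at the reference site or ONE FORWARD unit move from it,
  `…PlaquetteTermDisplacement.exists_unit_plaquetteBonds`) ⊢ `((c_loc − (1+t⁻¹)·2^d·ℓ²·(π∕(2L))²·ab)∕(1+t))·Σ_c‖x c‖² ≤ F x`.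

NOT HERE (honest): the term data, the local floors `c_loc` (the per-cube gauge letters and the currency question Q-leaf05-g157-1), `F` := the full form; anything of
Bałaban's estimates.  BY-NAME EFFECT ON THE WALL: NONE.  NE7b NOT PRINTED ∕ NOT PROVED; spine PROVED 0∕9; rung (B)+1 on ONE finite T⁴ — NOT infinite volume,
NOT the mass gap, NOT Clay.
HONEST DEPENDENCY: continuum YM on T⁴ ⇐ BetaPertH ∧ nine spine estimates (0/9 proved); BetaPertH ⇐ (D1) ∧ (D4) ∧ CAP+tail; G-an2-4 gates asym, D1 and NE2/3/4.
-/

set_option autoImplicit false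

noncomputable section

open Finset
open Literature.MathematicalPhysics.QuantumFieldTheory.Balaban1983to89.B14.TentUnityTorus (tentZ)
open Summit.QuantumFields.BalabanUV.T4Continuum.NE7b.AdmissibleFloorSeminormTerms (ims_floor_of_linear_terms)
open Summit.QuantumFields.BalabanUV.T4Continuum.NE7b.SineTentQuadraticPartition (sum_sq_prod_sin_tent_eq_one abs_prod_sin_tent_sub_le_of_disp
  abs_prod_sin_tent_sub_le_of_unit card_varying_on_term_sin_tent_le card_varying_on_term_sin_tent_le_of_unit)

namespace Summit.QuantumFields.BalabanUV.T4Continuum.NE7b.SineTentFloor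

variable {A : Type*} [Fintype A] [DecidableEq A]
variable {J C : Type*} [Fintype J] [Fintype C]
variable {W V : Type*} [NormedAddCommGroup W] [NormedSpace ℝ W] [NormedAddCommGroup V] [NormedSpace ℝ V]

/-- **THE (h2) FLOOR WITH THE SINE-TENT QUADRATIC PARTITION** — AFST `ims_floor_of_linear_terms` with `h_S(c) := Π_ν sin(π∕2·tentZ L ((pt c)_ν − (S_ν·L + c₀)))`,
`hpart` exact, `λ = D·π∕(2L)`, `μ = (a+1)·2^{#A}` supplied by `…SineTentQuadraticPartition`. [folklore] -/
theorem ims_floor_of_sine_tent_partition [DecidableEq C] (L M N : ℕ) [NeZero M] [NeZero N] (hL : 0 < L) (hM : 2 ≤ M) (hN : N = M * L) (c₀ : ℕ)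
    (inc : J → Finset C) (R : J → C → W →ₗ[ℝ] V) {ℓ : ℝ} (hR : ∀ j c v, ‖R j c v‖ ≤ ℓ * ‖v‖)
    (pt : C → A → ZMod N) (ref : J → C) (D : ℕ)
    (hdisp : ∀ j, ∀ b ∈ inc j, ∃ wp wm : A → ℕ,
      pt b = pt (ref j) + (fun ν => ((wp ν : ℕ) : ZMod N)) - (fun ν => ((wm ν : ℕ) : ZMod N)) ∧ ∑ ν, wp ν + ∑ ν, wm ν ≤ D)
    {a b : ℕ} (ha : ∀ j, (inc j).card ≤ a) (hb : ∀ c, (Finset.univ.filter fun j => c ∈ inc j).card ≤ b)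
    (good : (C → W) → Prop) {cloc : ℝ}
    (hloc : ∀ (S : A → ZMod M) (x : C → W), good x →
      cloc * ∑ c, ‖(∏ ν, Real.sin (Real.pi / 2 * tentZ (L : ℝ) (pt c ν - (((S ν).val * L + c₀ : ℕ) : ZMod N)))) • x c‖ ^ 2
        ≤ ∑ j, ‖∑ c ∈ inc j, R j c ((∏ ν, Real.sin (Real.pi / 2 * tentZ (L : ℝ) (pt c ν - (((S ν).val * L + c₀ : ℕ) : ZMod N)))) • x c)‖ ^ 2)
    (F : (C → W) → ℝ) (hF : ∀ x, good x → ∑ j, ‖∑ c ∈ inc j, R j c (x c)‖ ^ 2 ≤ F x)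
    {t : ℝ} (ht : 0 < t) (x : C → W) (hx : good x) :
    (cloc - (1 + t⁻¹) * ((((a + 1) * 2 ^ Fintype.card A : ℕ) : ℝ) * ℓ ^ 2 * (D * (Real.pi / (2 * L))) ^ 2 * a * b)) / (1 + t)
      * ∑ c, ‖x c‖ ^ 2 ≤ F x :=
  ims_floor_of_linear_terms (ι := A → ZMod M) inc R hR
    (fun (S : A → ZMod M) (c : C) => ∏ ν, Real.sin (Real.pi / 2 * tentZ (L : ℝ) (pt c ν - (((S ν).val * L + c₀ : ℕ) : ZMod N))))
    (fun c => sum_sq_prod_sin_tent_eq_one L M N hL hM hN c₀ (pt c)) ref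
    (lam := D * (Real.pi / (2 * L))) (by positivity)
    (fun S j c hc => abs_prod_sin_tent_sub_le_of_disp L M N hL hM hN c₀ pt inc ref D hdisp S j c hc)
    (μ := (a + 1) * 2 ^ Fintype.card A) (card_varying_on_term_sin_tent_le L M N hL hN c₀ pt inc ref ha) ha hb good hloc F hF ht x hx

/-- **… IN THE PLAQUETTE SHAPE** (`hunit`): `λ = π∕(2L)`, `μ = 2^{#A}` ⊢ `((c_loc − (1+t⁻¹)·2^d·ℓ²·(π∕(2L))²·ab)∕(1+t))·Σ_c‖x c‖² ≤ F x`. [folklore] -/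
theorem ims_floor_of_sine_tent_partition_unit [DecidableEq C] (L M N : ℕ) [NeZero M] [NeZero N] (hL : 0 < L) (hM : 2 ≤ M) (hN : N = M * L) (c₀ : ℕ)
    (inc : J → Finset C) (R : J → C → W →ₗ[ℝ] V) {ℓ : ℝ} (hR : ∀ j c v, ‖R j c v‖ ≤ ℓ * ‖v‖)
    (pt : C → A → ZMod N) (ref : J → C)
    (hunit : ∀ j, ∀ b ∈ inc j, pt b = pt (ref j) ∨ ∃ ν, pt b = Function.update (pt (ref j)) ν (pt (ref j) ν + 1))
    {a b : ℕ} (ha : ∀ j, (inc j).card ≤ a) (hb : ∀ c, (Finset.univ.filter fun j => c ∈ inc j).card ≤ b)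
    (good : (C → W) → Prop) {cloc : ℝ}
    (hloc : ∀ (S : A → ZMod M) (x : C → W), good x →
      cloc * ∑ c, ‖(∏ ν, Real.sin (Real.pi / 2 * tentZ (L : ℝ) (pt c ν - (((S ν).val * L + c₀ : ℕ) : ZMod N)))) • x c‖ ^ 2
        ≤ ∑ j, ‖∑ c ∈ inc j, R j c ((∏ ν, Real.sin (Real.pi / 2 * tentZ (L : ℝ) (pt c ν - (((S ν).val * L + c₀ : ℕ) : ZMod N)))) • x c)‖ ^ 2)
    (F : (C → W) → ℝ) (hF : ∀ x, good x → ∑ j, ‖∑ c ∈ inc j, R j c (x c)‖ ^ 2 ≤ F x)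
    {t : ℝ} (ht : 0 < t) (x : C → W) (hx : good x) :
    (cloc - (1 + t⁻¹) * ((((2 ^ Fintype.card A : ℕ)) : ℝ) * ℓ ^ 2 * (Real.pi / (2 * L)) ^ 2 * a * b)) / (1 + t) * ∑ c, ‖x c‖ ^ 2 ≤ F x :=
  ims_floor_of_linear_terms (ι := A → ZMod M) inc R hR
    (fun (S : A → ZMod M) (c : C) => ∏ ν, Real.sin (Real.pi / 2 * tentZ (L : ℝ) (pt c ν - (((S ν).val * L + c₀ : ℕ) : ZMod N))))
    (fun c => sum_sq_prod_sin_tent_eq_one L M N hL hM hN c₀ (pt c)) ref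
    (lam := Real.pi / (2 * L)) (by positivity)
    (fun S j c hc => abs_prod_sin_tent_sub_le_of_unit L M N hL hM hN c₀ pt inc ref hunit S j c hc)
    (μ := 2 ^ Fintype.card A) (card_varying_on_term_sin_tent_le_of_unit L M N hL hM hN c₀ pt inc ref hunit) ha hb good hloc F hF ht x hx

end Summit.QuantumFields.BalabanUV.T4Continuum.NE7b.SineTentFloor

end
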